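import Literature.MathematicalPhysics.QuantumFieldTheory.Balaban1983to89.B8Prop5UniqSectEW
import Literature.MathematicalPhysics.QuantumFieldTheory.Balaban1983to89.B8Prop5UniqKLevelBSrcPer
import Literature.MathematicalPhysics.QuantumFieldTheory.Balaban1983to89.B8SectEKLevelPer

/-!
# `Balaban1983to89.B8Prop5UniqSectEWSrcPer` — [Balaban1985RegularSpaces] Prop. 5 (1.109) «EXACTLY ONE λ′» WITH SECT. E INSTANTIATED, ON THE TORUS
# (§3 p. 98), AT THEOREM 8's SOURCED GAUGE CONDITION (1.146) p. 101: `B8Prop5UniqSectEWPer` (t2s-1's periodic uniqueness JOIN: (U1), (U2), (1.91)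
# read at PERIODIC arguments only) re-run on the periodic SOURCED engine `B8Prop5UniqKLevelBSrcPer` — engine E2 of the nested server's instance (ii)
# (IR B8-P5-NESTED-SERVER)

statement-level skeleton of published theorems with citation tags; proofs where landed; nothing here is a claim about the
Yang–Mills mass gap

T. Bałaban, *Spaces of regular gauge field configurations on a lattice and gauge fixing conditions*, Commun. Math. Phys. **99** (1985) 75–102
`[Balaban1985RegularSpaces]` ("B8"; journal page = PDF page + 74): Prop. 5 (1.109) p. 94, (1.113)–(1.125) pp. 95–97, (1.112) p. 95, (1.91)–(1.92)
p. 91, (1.29) p. 81, Thm 8 (1.146) p. 101 («there exists exactly one gauge transformation u …»), §3 p. 98 (the torus).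
T. Bałaban, *Propagators …*, CMP **99** (1985) 389–434 `[Balaban1985BackgroundPropagators]` ([4]): Thm 3.1 p. 397, (3.25) p. 394.  STATUS: published, refereed.

CITATION HEADER (lean-in-tree rule).  Cell `lit-balaban`, seat `lit-balaban-p21` (gen 39), IR B8-P5-NESTED-SERVER (pub-ymgap dag-n05-c), instance (ii)
(Theorem 8's source), engine E2 of the periodic × sourced stack E0 `B8Prop5ContractionKLevelSrcPer` → E1 `B8Prop5UniqKLevelBSrcPer` → E2 (this file).
WHAT IS PROVED (0 sorry, no `def`): ★ `hFP_unique_of_sectE_local_wb_src_per` — `B8Prop5UniqSectEWPer.hFP_unique_of_sectE_local_wb_per` VERBATIM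
((U1) `g_leftB` at PERIODIC bounded functions, (U2) `c_left'` at level-PERIODIC multipliers, (1.91) `hQH` at level-PERIODIC families; torus data
displayed: `Lʲ ∣ P`, shift-invariant `Λ_j`, periodic `U₀`, `A`, `u₁`; `G′` periodic-valued, `𝔄` level-periodic-valued, `H′` periodicity-preserving;
the two competitors PERIODIC with level-periodic Landau multipliers; `D′` = `B8SectEKLevelPer.exists_Dprime_kLevel_w_per`) with dag-n05-d's
`B8Prop5UniqSectEWSrc` diff applied token for token: the competitors' Landau clauses are THE MULTIPLIER FORM OF (1.146) (`… − f`), the source `f` is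
a fixed PERIODIC function with finite `|f|₍₋₂₎` on the `Ω_j`, the two smallness windows are read at `hE₂ + m_f∕2`, engine =
`B8Prop5UniqKLevelBSrcPer.hFP_unique_of_cond146_bdd_per`.  CONCLUSION: `λ′₁ = λ′₂`.

HONEST SCOPE.  Verbatim re-thread; [4], Sect. E NOT proved (displayed); the level-periodic-multiplier premise is extra relative to print (see
`B8Prop5UniqKLevelBPer`); count-neutral; N05 ∕ `stub_PV3A` NOT discharged; one finite `T⁴` programme at fixed `ε`, Bałaban as printed — nothing
continuum ∕ ℝ⁴ ∕ OS ∕ mass-gap ∕ Clay — the Yang–Mills mass gap is NOT proved.  No `sorry`, no `def`, no `… : Prop` fact, no `instance`, no `notation`.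
Unit `lit-balaban-p21` (g39), 2026-08-28.

[cite: Balaban1985RegularSpaces, Prop. 5 (1.109) p.94, (1.113)–(1.125) pp.95–97, (1.112) p.95, (1.91) p.91, (1.29) p.81, Thm 8 (1.146) p.101, §3 p.98; Balaban1985BackgroundPropagators, Thm 3.1 p.397, (3.25) p.394]
-/

noncomputable section

open NormedSpace Metric Set Filter Topology
open Complex (I)
open scoped BigOperators

namespace Literature.MathematicalPhysics.QuantumFieldTheory.Balaban1983to89.B8Prop5UniqSectEWSrcPer

open B7Prop1Explicit (e U1 expUnit val_inv_expUnit val_expUnit)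
open B7Prop2Explicit (unitaryUnits mem_unitaryUnits unitaryUnits_le_U1 avgClosed_unitaryUnits AvgClosed C0 c2')
open B7Prop1Local (InBox pdevOn clampCfg)
open B7Prop3Flat (expCfg c3)
open B7Eq78Linearization (conjR zdBlocking QprimeIter QprimeIter_smul)
open B7Eq167Flat (InLambda)
open B7Eq170Flat (cj cj_apply)
open B7Prop10General (C6 C4G utilG)
open B7Prop10Flat (one_le_C5 C4'_nonneg C5'_nonneg)
open B7Prop9Flat (C5')
open B7Eq214General (Cgen)
open B8Ineq130 (tlo thi tlo_zero thi_zero)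
open B7Eq84Concrete (uavg)
open B7Eq92Concrete (mgauge)
open B8Eq119TwistedAxial (bgT InAx Restr129)
open B8Eq178Averages (util178 Qnl Cond179 restr129_iff_uavg utilG_eq_uavg_mul_inv util178_eq_utilG)
open B8Eq1123Concrete (Cnl cj_smul_complex)
open B8Ineq125Concrete (C2p C2p_nonneg)
open B8Eq1117Concrete (XSpace)
open B8DprimeKLevelLipschitz (smallness_prod)
open B8SectEInLambdaWitness (witness_inv_of_unitary)
open B8SectEKLevelInLambda (Dprime_lipschitz_kLevel_w)
open B8SectEKLevelPer (exists_Dprime_kLevel_w_per)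
open B8Ineq132 (covDerivFwd covDeriv norm_conjR)
open B8Eq151V2Divergence (covDerivFwd_smul)
open B8Eq138LandauZd (covLap covDivB QT)
open B8Eq182Proof (gAd)
open B8Eq184Proof (gaugeExp)
open B8Eq188Proof (frakF3)
open B8LambdaSpaceKLevel (wt wt_pos wt_nonneg lamSubK lamOf lamOf_sub norm_lamOf_le weight_mul_norm_covDerivFwd_le norm_cjDiff_lamOf_le
  norm_le_iff norm_sub_le_iff covDerivFwd_sub')
open B8Prop5ContractionKLevel (Bd2 Mc Kc)
open B8Prop5KLevelLetters (covLap_sub)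
open B8Prop5JoinSectE (ball_sub_119 ball_diff_modulus hH1_tower cjDiff_le_of_weighted covLap_smul)
open B8Prop5GaugeParamKLevel (gpar_size)
open B8Prop5UniqSectE (cond179_gaugeExp_of_restr129_local)
open B8Prop5UniqKLevelBSrcPer (hFP_unique_of_cond146_bdd_per)

-- `Site` alone could resolve to the torus sites of `Setup.lean`; re-export the `ℤ^d` sites of `B7Prop1Explicit`.
export B7Prop1Explicit (Site)

variable {d : ℕ} {𝔸 : Type*} [CStarAlgebra 𝔸] [Nontrivial 𝔸]

section Bookkeeping

omit [Nontrivial 𝔸] in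
/-- `‖(−i)·a‖ = ‖a‖`. [folklore] -/
private theorem norm_negI_smul (a : 𝔸) : ‖(-I) • a‖ = ‖a‖ := by
  rw [norm_smul, norm_neg, Complex.norm_I, one_mul]

end Bookkeeping

section SectEWSrc

variable {L k : ℕ} {η : ℝ} {Ω Λs : ℕ → Set (Site d)} {Eb : ℕ → Set (Site d × Fin d)} {U₀ : Site d → Fin d → 𝔸ˣ}
  {A : Site d → Fin d → 𝔸} {u₁ : Site d → 𝔸ˣ}

/-- ★ **PROPOSITION 5's UNIQUENESS CLAUSE AT PRINT's GENERALITY, SOURCED GAUGE CONDITION (Theorem 8's (1.146)), ON THE TORUS** —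
`B8Prop5UniqSectEWPer.hFP_unique_of_sectE_local_wb_per` VERBATIM ((U1), (U2), (1.91) at periodic arguments; Λ_j-WITNESSES for `u₁`, free `α₃`, Sect. E
correction `H_c = −i·H′D′` instantiated with its sizes ∕ moduli by the periodic `D′`, (1.79) for the inverse pairs from (1.29) by the local route) over the
periodic SOURCED engine `B8Prop5UniqKLevelBSrcPer.hFP_unique_of_cond146_bdd_per`: the two PERIODIC competitors' level-periodic multiplier clauses carry
the source (`Δ↾Ω₀[D*A + Δλ′ᵢ + 𝔑(λ′ᵢ) − f] = Q′ᵀμᵢ`), `f` a fixed PERIODIC function with finite `|f|₍₋₂₎` on the `Ω_j`, and the two smallness windows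
are read at `hE₂ + m_f∕2`.  CONCLUSION: `λ′₁ = λ′₂`.
[cite: Balaban1985RegularSpaces, Prop. 5 (1.109) p.94, (1.113)–(1.125) pp.95–97, (1.112) p.95, (1.91) p.91, (1.29) p.81, Thm 8 (1.146) p.101, §3 p.98; Balaban1985BackgroundPropagators, Thm 3.1 p.397, (3.25) p.394] -/
theorem hFP_unique_of_sectE_local_wb_src_per (hL : 2 ≤ L) (hη : 0 < η) (hU₀ : ∀ x κ, U₀ x κ ∈ unitaryUnits 𝔸) (P : ℤ) (hΩ0 : Ω 0 = Set.univ)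
    (hEbΩ : ∀ j, j ≤ k → ∀ x ∈ Ω j, ∀ μ : Fin d, (x, μ) ∈ Eb j ∧ (x - e μ, μ) ∈ Eb j)
    (hEbT : ∀ j, j ≤ k → ∀ y ∈ Λs j, ∀ (x : Site d) (κ : Fin d), InBox (tlo L y j) (thi L y j) x →
      InBox (tlo L y j) (thi L y j) (x + e κ) → (x, κ) ∈ Eb j)
    -- letters of [4]
    (g Δ : (Site d → 𝔸) →ₗ[ℂ] (Site d → 𝔸)) (q : (Site d → 𝔸) →ₗ[ℂ] (ℕ → Site d → 𝔸)) (qs : (ℕ → Site d → 𝔸) →ₗ[ℂ] (Site d → 𝔸))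
    (Aw c : (ℕ → Site d → 𝔸) →ₗ[ℂ] (ℕ → Site d → 𝔸))
    (g_leftB : ∀ x : Site d → 𝔸, (∀ (z : Site d) (i : Fin d), x (z + P • e i) = x z) → (∃ C : ℝ, ∀ y, ‖x y‖ ≤ C) → g (Δ x + qs (Aw (q x))) = x)
    (c_left' : ∀ φ : ℕ → Site d → 𝔸, (∀ j, j ≤ k → ∀ (y : Site d) (i : Fin d), φ j (y + (P / (L : ℤ) ^ j) • e i) = φ j y) → qs (c (q (g (g (qs φ))))) = qs φ)
    (hΔ : ∀ (f : Site d → 𝔸), ∀ x ∈ Ω 0, Δ f x = covLap η U₀ ((Ω 0).indicator f) x)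
    (hqs : ∀ (μ : ℕ → Site d → 𝔸), ∀ x ∈ Ω 0, qs μ x = QT L k Λs U₀ μ x)
    (hq : ∀ (f : Site d → 𝔸) (j : ℕ), j ≤ k → ∀ y ∈ Λs j, q f j y = QprimeIter (zdBlocking d L) (bgT L U₀) j f y)
    (hq0 : ∀ (f : Site d → 𝔸) (j : ℕ) (y : Site d), ¬ (j ≤ k ∧ y ∈ Λs j) → q f j y = 0)
    -- the torus: every `Lʲ ∣ P`, shift-invariant `Λ_j`, periodic `U₀`, `A`, `u₁`; `G′` periodic-valued, `𝔄` level-periodic-valued, `H′` periodicity-preserving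
    (hdiv : ∀ j, j ≤ k → ((L : ℤ) ^ j ∣ P))
    (hΛ : ∀ j, j ≤ k → ∀ (y : Site d) (i : Fin d), y + (P / (L : ℤ) ^ j) • e i ∈ Λs j ↔ y ∈ Λs j)
    (hU₀per : ∀ (z : Site d) (i : Fin d), U₀ (z + P • e i) = U₀ z) (hAper : ∀ (z : Site d) (i : Fin d), A (z + P • e i) = A z)
    (hu₁per : ∀ (z : Site d) (i : Fin d), u₁ (z + P • e i) = u₁ z)
    (hGper : ∀ (f : Site d → 𝔸) (z : Site d) (i : Fin d), g f (z + P • e i) = g f z)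
    (hAw_per : ∀ μ : ℕ → Site d → 𝔸, (∀ j, j ≤ k → ∀ (y : Site d) (i : Fin d), Aw μ j (y + (P / (L : ℤ) ^ j) • e i) = Aw μ j y))
    -- the letter H′ of [4] ((1.91)–(1.92)) and the Sect. E / local-inversion regime (tower-local, everything AT u₁)
    (H' : XSpace d k 𝔸 →ₗ[ℂ] (Site d → 𝔸)) {α₀ α₃ α₄ B₀' B₂' : ℝ}
    (hα : 0 < α₀) (hα3 : C0 d * α₀ ≤ 1 / 3) (hα4 : 4 * α₀ ≤ c2' d L) (hα₃ : 0 ≤ α₃) (hα₄ : 0 < α₄) (hB : 0 < B₀') (hB₂ : 0 ≤ B₂')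
    (h33 : ∀ j, j ≤ k → ∀ y ∈ Λs j, pdevOn (tlo L y j) (thi L y j) U₀ < α₀ * (((L : ℝ) ^ j)⁻¹) ^ 2)
    -- print's tower regime of `u₁` ((1.73)/(1.74) ⇒ (166)/(167) on Bʲ(Λ_j), p. 89) as UNITARY Λ_j-WITNESSES, and (1.68) ⇒ (1.29)
    (hwit : ∀ j, j ≤ k → ∀ y ∈ Λs j, ∃ ut : Site d → 𝔸ˣ, (∀ x, ut x ∈ unitaryUnits 𝔸) ∧
      InLambda L (clampCfg (tlo L y j) (thi L y j) U₀) ut j α₃ (((L : ℝ) ^ j)⁻¹) ∧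
      ∀ x : Site d, tlo L y j ≤ x → x ≤ thi L y j → u₁ x = ut x)
    (h129 : Restr129 L k Λs U₀ u₁)
    (hH0 : ∀ (X : XSpace d k 𝔸) (x : Site d), ‖H' X x‖ ≤ B₀' * ‖X‖)
    (hH1 : ∀ j, j ≤ k → ∀ (X : XSpace d k 𝔸), ∀ p ∈ Eb j, wt L η j * ‖covDerivFwd η U₀ p.2 (H' X) p.1‖ ≤ B₀' * ‖X‖)
    (hH2 : ∀ X : XSpace d k 𝔸, Bd2 L η k Ω (covLap η U₀ (H' X)) (B₂' * ‖X‖))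
    (hHper : ∀ X : XSpace d k 𝔸, (∀ (p : Fin (k + 1) × Site d) (i : Fin d), X (p.1, p.2 + (P / (L : ℤ) ^ (p.1 : ℕ)) • e i) = X p) →
      ∀ (z : Site d) (i : Fin d), H' X (z + P • e i) = H' X z)
    (hQH : ∀ (Y : XSpace d k 𝔸), (∀ (p : Fin (k + 1) × Site d) (i : Fin d), Y (p.1, p.2 + (P / (L : ℤ) ^ (p.1 : ℕ)) • e i) = Y p) →
      ∀ (j : ℕ) (hj : j ≤ k) (y : Site d), y ∈ Λs j →
      QprimeIter (zdBlocking d L) (bgT L U₀) j (H' Y) y = Y (⟨j, Nat.lt_succ_of_le hj⟩, y))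
    (hα₃' : α₃ ≤ 1 / 200)
    (hs₁ : 200 * C6 d * (2 * α₄) ≤ 1) (hs₂ : 12000 * ((d : ℝ) + 1) * L * (2 * α₄) ≤ 1)
    (hs₃ : C4G d L * (α₀ + α₃ + 4 * (2 * α₄)) ≤ 1)
    (hs₄ : 1024 * ((d : ℝ) + 1) * ((d : ℝ) + 4) * L ^ 2 * α₀ ≤ 1) (hs₅ : 32 * ((d : ℝ) + 1) ^ 2 * C6 d * L ^ 2 * α₀ ≤ 1)
    (hs₆ : 16 * d * C5' d * C6 d * (L : ℝ) ^ 2 * α₀ ≤ 1) (hs₇ : 8 * d * C6 d * L * α₀ ≤ 1)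
    (hsm : α₃ + α₄ ≤ 1 / (4 * B₀' * (2 * C2p d))) (hprod8 : 2 * C6 d * (α₃ + 4 * α₄) ≤ 1 / 8)
    -- the Sect. E sizes of H_c (named, so that the windows below read)
    {hE hE₂ lE lE₂ : ℝ} (hE_def : hE = B₀' * (C2p d * (α₃ + α₄) * α₄)) (hE₂_def : hE₂ = B₂' * (C2p d * (α₃ + α₄) * α₄))
    (lE_def : lE = B₀' * (4 * C2p d * (α₃ + 2 * α₄))) (lE₂_def : lE₂ = B₂' * (4 * C2p d * (α₃ + 2 * α₄)))
    -- JOIN-B's letters G′, R, the datum, and its windows at these sizes; the two uniqueness windows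
    {BG BR cA cDA ρ : ℝ} (hBG : 0 ≤ BG) (hBR : 0 ≤ BR) (hcA : 0 ≤ cA) (hcA' : cA ≤ 1 / 13) (hcDA : 0 ≤ cDA)
    (ha₁' : α₄ / 4 + hE ≤ 1 / 24) (hb₁' : α₄ / 4 + hE ≤ 1 / 140) (hθ : 10 * (α₄ / 4 + hE) * BR ≤ 1 / 2)
    (hlE : lE ≤ 1 / 2) (hρ : ρ + hE ≤ α₄ / 4)
    (hG : ∀ (f : Site d → 𝔸) (m : ℝ), 0 ≤ m → Bd2 L η k Ω f m →
      (∀ x, ‖g f x‖ ≤ BG * m) ∧ ∀ j, j ≤ k → ∀ p ∈ Eb j, wt L η j * ‖covDerivFwd η U₀ p.2 (g f) p.1‖ ≤ BG * m)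
    (hRbd : ∀ (f : Site d → 𝔸) (m : ℝ), 0 ≤ m → Bd2 L η k Ω f m → Bd2 L η k Ω (f - g (qs (c (q (g f))))) (BR * m))
    (hDA : Bd2 L η k Ω (fun y => covDivB η U₀ A y) cDA)
    -- THE SOURCE `f` of (1.146): periodic, finite `|f|₍₋₂₎` on the `Ω_j`
    {f : Site d → 𝔸} {mf : ℝ} (hmf : 0 ≤ mf) (hf : Bd2 L η k Ω f mf) (hfper : ∀ (z : Site d) (i : Fin d), f (z + P • e i) = f z)
    (hA : ∀ j, j ≤ k → ∀ x ∈ Ω j, ∀ μ : Fin d,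
      wt L η j * ‖A x μ‖ ≤ cA ∧ wt L η j * ‖conjR (U₀ (x - e μ) μ)⁻¹ (A (x - e μ) μ)‖ ≤ cA)
    (h103 : BG * Mc d BR (α₄ / 4 + hE) cA (hE₂ + mf / 2) cDA ≤ α₄ / 4)
    (h106 : BG * Kc d BR (α₄ / 4 + hE) cA (hE₂ + mf / 2) cDA lE₂ (1 + lE) (1 + lE) ≤ 1 / 2)
    -- the two solutions
    {lam₁ lam₂ : Site d → 𝔸}
    (hl₁per : (∀ (z : Site d) (i : Fin d), lam₁ (z + P • e i) = lam₁ z)) (hl₁ : ∀ x, ‖lam₁ x‖ ≤ ρ) (hD₁ : ∀ j, j ≤ k → ∀ p ∈ Eb j, wt L η j * ‖covDerivFwd η U₀ p.2 lam₁ p.1‖ ≤ ρ)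
    (hmult₁ : ∃ μ : ℕ → Site d → 𝔸, (∀ j, j ≤ k → ∀ (y : Site d) (i : Fin d), μ j (y + (P / (L : ℤ) ^ j) • e i) = μ j y) ∧ ∀ x ∈ Ω 0,
      covLap η U₀ ((Ω 0).indicator fun y => covDivB η U₀ A y + covLap η U₀ lam₁ y +
        ((conjR (gaugeExp lam₁ y)⁻¹ (covDivB η U₀ A y) - covDivB η U₀ A y) +
          (gAd (covLap η U₀ lam₁ y) (lam₁ y) - covLap η U₀ lam₁ y) + ∑ μ, frakF3 η U₀ lam₁ A y μ) - f y) x = QT L k Λs U₀ μ x)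
    (h129₁ : Restr129 L k Λs U₀ (u₁ * gaugeExp lam₁))
    (hl₂per : (∀ (z : Site d) (i : Fin d), lam₂ (z + P • e i) = lam₂ z)) (hl₂ : ∀ x, ‖lam₂ x‖ ≤ ρ) (hD₂ : ∀ j, j ≤ k → ∀ p ∈ Eb j, wt L η j * ‖covDerivFwd η U₀ p.2 lam₂ p.1‖ ≤ ρ)
    (hmult₂ : ∃ μ : ℕ → Site d → 𝔸, (∀ j, j ≤ k → ∀ (y : Site d) (i : Fin d), μ j (y + (P / (L : ℤ) ^ j) • e i) = μ j y) ∧ ∀ x ∈ Ω 0,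
      covLap η U₀ ((Ω 0).indicator fun y => covDivB η U₀ A y + covLap η U₀ lam₂ y +
        ((conjR (gaugeExp lam₂ y)⁻¹ (covDivB η U₀ A y) - covDivB η U₀ A y) +
          (gAd (covLap η U₀ lam₂ y) (lam₂ y) - covLap η U₀ lam₂ y) + ∑ μ, frakF3 η U₀ lam₂ A y μ) - f y) x = QT L k Λs U₀ μ x)
    (h129₂ : Restr129 L k Λs U₀ (u₁ * gaugeExp lam₂)) :
    lam₁ = lam₂ := by
  have hL1 : 1 ≤ L := le_trans (by norm_num) hL
  have hC2 : 0 ≤ C2p d := C2p_nonneg d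
  have hhE : 0 ≤ hE := by rw [hE_def]; positivity
  have hhE₂ : 0 ≤ hE₂ := by rw [hE₂_def]; positivity
  have hlE0 : 0 ≤ lE := by rw [lE_def]; positivity
  have hlE₂ : 0 ≤ lE₂ := by rw [lE₂_def]; positivity
  have hb₁ : 0 < α₄ / 4 + hE := add_pos_of_pos_of_nonneg (by positivity) hhE
  have hρ0 : 0 ≤ ρ := (norm_nonneg _).trans (hl₁ 0)
  have hα2 : 2 * α₀ ≤ c2' d L := by linarith
  -- Λ_j-witnesses for the INVERSE `u₁⁻¹` (Sect. E runs on the inverse pair): `ũ⁻¹`, by the inverse-closure of `Λ_j` for unitary data ((1.112) p. 95)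
  have hwiti : ∀ j, j ≤ k → ∀ y ∈ Λs j, ∃ ut : Site d → 𝔸ˣ,
      InLambda L (clampCfg (tlo L y j) (thi L y j) U₀) ut j α₃ (((L : ℝ) ^ j)⁻¹) ∧
      ∀ x : Site d, tlo L y j ≤ x → x ≤ thi L y j → u₁⁻¹ x = ut x := by
    intro j hj y hy
    obtain ⟨ut, hun, hW, hag⟩ := hwit j hj y hy
    exact witness_inv_of_unitary hL hU₀ hα hα3 hα2 (h33 j hj y hy) hL1 hα₃ (by linarith) hun hW hag
  -- THE solution map D′(u₁⁻¹, −i·) on the ¼α₄-ball, chosen once (reality not needed)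
  have hu₁iper : ∀ (z : Site d) (i : Fin d), u₁⁻¹ (z + P • e i) = u₁⁻¹ z := fun z i => by rw [Pi.inv_apply, Pi.inv_apply, hu₁per z i]
  have key : ∀ lam : Site d → 𝔸, ∃ X : XSpace d k 𝔸, ∀ s : lamSubK η U₀ L k Eb, lamOf s = lam → (∀ (z : Site d) (i : Fin d), lamOf s (z + P • e i) = lamOf s z) → ‖s‖ ≤ α₄ / 4 →
      (∀ (p : Fin (k + 1) × Site d) (i : Fin d), X (p.1, p.2 + (P / (L : ℤ) ^ (p.1 : ℕ)) • e i) = X p) ∧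
      ‖X‖ ≤ α₄ / (2 * B₀') ∧ ‖X‖ ≤ C2p d * (α₃ + α₄) * α₄ ∧
      (∀ (j : ℕ) (hj : j ≤ k) (y : Site d), y ∉ Λs j → X (⟨j, Nat.lt_succ_of_le hj⟩, y) = 0) ∧
      (∀ (j : ℕ) (hj : j ≤ k) (y : Site d), y ∈ Λs j →
        Cnl L U₀ u₁⁻¹ j ((-I) • lamOf s - H' X) y = X (⟨j, Nat.lt_succ_of_le hj⟩, y)) ∧
      ∀ (j : ℕ), j ≤ k → ∀ y ∈ Λs j,
        Qnl L U₀ (fun x => expUnit (((-I) • lamOf s - H' X) x)) u₁⁻¹ j y = QprimeIter (zdBlocking d L) (bgT L U₀) j ((-I) • lamOf s) y := by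
    intro lam
    by_cases h : ∃ s : lamSubK η U₀ L k Eb, lamOf s = lam ∧ (∀ (z : Site d) (i : Fin d), lamOf s (z + P • e i) = lamOf s z) ∧ ‖s‖ ≤ α₄ / 4
    · obtain ⟨s, rfl, hp, hs⟩ := h
      obtain ⟨h119b, h119a⟩ := ball_sub_119 (Λs := Λs) hL1 hη hα₄ hEbT s hs
      obtain ⟨X, hX⟩ := exists_Dprime_kLevel_w_per (Λ := Λs) (lam := (-I) • lamOf s) (u₁ := u₁⁻¹) hL hL1 (avgClosed_unitaryUnits d L) hU₀ hα
        hα3 hα4 hα₃ hα₄ hB h33 hwiti h119b h119a hH0 (hH1_tower hL1 hη H' hEbT hH1) P hdiv hΛ hU₀per hu₁iper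
        (fun z i => by simp only [Pi.smul_apply, hp z i]) hHper hQH hα₃' hs₁ hs₂ hs₃ hs₄ hs₅ hs₆ hs₇ hsm
      refine ⟨X, fun t ht _ _ => ?_⟩
      rw [B8LambdaSpaceKLevel.ext_of_lamOf ht]
      exact hX
    · exact ⟨0, fun s h1 h2 h3 => absurd ⟨s, h1, h2, h3⟩ h⟩
  choose Dp hDp' using key
  have hDp := fun (s : lamSubK η U₀ L k Eb) (hp : (∀ (z : Site d) (i : Fin d), lamOf s (z + P • e i) = lamOf s z)) (hs : ‖s‖ ≤ α₄ / 4) =>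
    hDp' (lamOf s) s rfl hp hs
  have hDpL : ∀ s t : lamSubK η U₀ L k Eb, (∀ (z : Site d) (i : Fin d), lamOf s (z + P • e i) = lamOf s z) → (∀ (z : Site d) (i : Fin d), lamOf t (z + P • e i) = lamOf t z) →
      ‖s‖ ≤ α₄ / 4 → ‖t‖ ≤ α₄ / 4 → ‖Dp (lamOf s) - Dp (lamOf t)‖ ≤ 4 * C2p d * (α₃ + 2 * α₄) * ‖s - t‖ := fun s t hps hpt hs ht =>
    by
    obtain ⟨h₁b, h₁a⟩ := ball_sub_119 (Λs := Λs) hL1 hη hα₄ hEbT s hs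
    obtain ⟨h₂b, h₂a⟩ := ball_sub_119 (Λs := Λs) hL1 hη hα₄ hEbT t ht
    obtain ⟨hmb, hma⟩ := ball_diff_modulus (Λs := Λs) hL1 hη hEbT s t
    exact Dprime_lipschitz_kLevel_w (Λ := Λs) (lam₁ := (-I) • lamOf s) (lam₂ := (-I) • lamOf t) (u₁ := u₁⁻¹) hL hL1
      (avgClosed_unitaryUnits d L) hU₀ hα hα3 hα4 hα₃ hα₄ hB (norm_nonneg _) h33 hwiti h₁b h₁a h₂b h₂a hmb hma hH0
      (hH1_tower hL1 hη H' hEbT hH1) hα₃' hs₁ hs₂ hs₃ hs₄ hs₅ hs₆ hs₇ hsm (hDp s hps hs).2.1 (hDp t hpt ht).2.1 (hDp s hps hs).2.2.2.1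
      (hDp s hps hs).2.2.2.2.1 (hDp t hpt ht).2.2.2.1 (hDp t hpt ht).2.2.2.2.1
  -- sizes of D′ and of its differences, multiplied by the (1.92) constants
  have hbdX : ∀ s : lamSubK η U₀ L k Eb, (∀ (z : Site d) (i : Fin d), lamOf s (z + P • e i) = lamOf s z) → ‖s‖ ≤ α₄ / 4 → B₀' * ‖Dp (lamOf s)‖ ≤ hE := fun s hp hs => by
    rw [hE_def]; exact mul_le_mul_of_nonneg_left (hDp s hp hs).2.2.1 hB.le
  have hbdX₂ : ∀ s : lamSubK η U₀ L k Eb, (∀ (z : Site d) (i : Fin d), lamOf s (z + P • e i) = lamOf s z) → ‖s‖ ≤ α₄ / 4 → B₂' * ‖Dp (lamOf s)‖ ≤ hE₂ := fun s hp hs => by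
    rw [hE₂_def]; exact mul_le_mul_of_nonneg_left (hDp s hp hs).2.2.1 hB₂
  have hbdL : ∀ s t : lamSubK η U₀ L k Eb, (∀ (z : Site d) (i : Fin d), lamOf s (z + P • e i) = lamOf s z) → (∀ (z : Site d) (i : Fin d), lamOf t (z + P • e i) = lamOf t z) →
      ‖s‖ ≤ α₄ / 4 → ‖t‖ ≤ α₄ / 4 → B₀' * ‖Dp (lamOf s) - Dp (lamOf t)‖ ≤ lE * ‖s - t‖ :=
    fun s t hps hpt hs ht => by
    rw [lE_def, mul_assoc]; exact mul_le_mul_of_nonneg_left (hDpL s t hps hpt hs ht) hB.le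
  have hbdL₂ : ∀ s t : lamSubK η U₀ L k Eb, (∀ (z : Site d) (i : Fin d), lamOf s (z + P • e i) = lamOf s z) → (∀ (z : Site d) (i : Fin d), lamOf t (z + P • e i) = lamOf t z) →
      ‖s‖ ≤ α₄ / 4 → ‖t‖ ≤ α₄ / 4 → B₂' * ‖Dp (lamOf s) - Dp (lamOf t)‖ ≤ lE₂ * ‖s - t‖ :=
    fun s t hps hpt hs ht => by
    rw [lE₂_def, mul_assoc]; exact mul_le_mul_of_nonneg_left (hDpL s t hps hpt hs ht) hB₂
  have hsubH : ∀ s t : lamSubK η U₀ L k Eb, (-I) • H' (Dp (lamOf s)) - (-I) • H' (Dp (lamOf t)) = (-I) • H' (Dp (lamOf s) - Dp (lamOf t)) :=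
    fun s t => by rw [map_sub, smul_sub]
  -- the six binders of the engine for `H_c λ := −i·H′D′(u₁⁻¹, −iλ)`
  have hc0 : ∀ s : lamSubK η U₀ L k Eb, (∀ (z : Site d) (i : Fin d), lamOf s (z + P • e i) = lamOf s z) → ‖s‖ ≤ α₄ / 4 →
      ∀ x, ‖((-I) • H' (Dp (lamOf s))) x‖ ≤ hE := fun s hp hs x => by
    rw [Pi.smul_apply, norm_negI_smul]; exact (hH0 _ x).trans (hbdX s hp hs)
  have hc1 : ∀ s : lamSubK η U₀ L k Eb, (∀ (z : Site d) (i : Fin d), lamOf s (z + P • e i) = lamOf s z) → ‖s‖ ≤ α₄ / 4 → ∀ j, j ≤ k → ∀ p ∈ Eb j,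
      wt L η j * ‖covDerivFwd η U₀ p.2 ((-I) • H' (Dp (lamOf s))) p.1‖ ≤ hE := fun s hp hs j hj p hpj => by
    rw [covDerivFwd_smul, norm_negI_smul]; exact (hH1 j hj _ p hpj).trans (hbdX s hp hs)
  have hc2 : ∀ s : lamSubK η U₀ L k Eb, (∀ (z : Site d) (i : Fin d), lamOf s (z + P • e i) = lamOf s z) → ‖s‖ ≤ α₄ / 4 →
      Bd2 L η k Ω (covLap η U₀ ((-I) • H' (Dp (lamOf s)))) hE₂ :=
    fun s hp hs j hj x hx => by
    rw [covLap_smul, norm_negI_smul]; exact (hH2 _ j hj x hx).trans (hbdX₂ s hp hs)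
  have hcL0 : ∀ s t : lamSubK η U₀ L k Eb, (∀ (z : Site d) (i : Fin d), lamOf s (z + P • e i) = lamOf s z) → (∀ (z : Site d) (i : Fin d), lamOf t (z + P • e i) = lamOf t z) →
      ‖s‖ ≤ α₄ / 4 → ‖t‖ ≤ α₄ / 4 → ∀ x,
      ‖((-I) • H' (Dp (lamOf s))) x - ((-I) • H' (Dp (lamOf t))) x‖ ≤ lE * ‖s - t‖ := fun s t hps hpt hs ht x => by
    rw [← Pi.sub_apply, hsubH, Pi.smul_apply, norm_negI_smul]; exact (hH0 _ x).trans (hbdL s t hps hpt hs ht)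
  have hcL1 : ∀ s t : lamSubK η U₀ L k Eb, (∀ (z : Site d) (i : Fin d), lamOf s (z + P • e i) = lamOf s z) → (∀ (z : Site d) (i : Fin d), lamOf t (z + P • e i) = lamOf t z) →
      ‖s‖ ≤ α₄ / 4 → ‖t‖ ≤ α₄ / 4 → ∀ j, j ≤ k → ∀ p ∈ Eb j,
      wt L η j * ‖covDerivFwd η U₀ p.2 ((-I) • H' (Dp (lamOf s)) - (-I) • H' (Dp (lamOf t))) p.1‖ ≤ lE * ‖s - t‖ :=
    fun s t hps hpt hs ht j hj p hpj => by
    rw [hsubH, covDerivFwd_smul, norm_negI_smul]; exact (hH1 j hj _ p hpj).trans (hbdL s t hps hpt hs ht)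
  have hcper : ∀ s : lamSubK η U₀ L k Eb, (∀ (z : Site d) (i : Fin d), lamOf s (z + P • e i) = lamOf s z) → ‖s‖ ≤ α₄ / 4 →
      ∀ (z : Site d) (i : Fin d), ((-I) • H' (Dp (lamOf s))) (z + P • e i) = ((-I) • H' (Dp (lamOf s))) z := fun s hp hs z i => by
    rw [Pi.smul_apply, Pi.smul_apply, hHper _ (hDp s hp hs).1 z i]
  have hcL2 : ∀ s t : lamSubK η U₀ L k Eb, (∀ (z : Site d) (i : Fin d), lamOf s (z + P • e i) = lamOf s z) → (∀ (z : Site d) (i : Fin d), lamOf t (z + P • e i) = lamOf t z) →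
      ‖s‖ ≤ α₄ / 4 → ‖t‖ ≤ α₄ / 4 →
      Bd2 L η k Ω (covLap η U₀ ((-I) • H' (Dp (lamOf s))) - covLap η U₀ ((-I) • H' (Dp (lamOf t)))) (lE₂ * ‖s - t‖) :=
    fun s t hps hpt hs ht j hj x hx => by
    rw [Pi.sub_apply, ← covLap_sub, hsubH, covLap_smul, norm_negI_smul]; exact (hH2 _ j hj x hx).trans (hbdL₂ s t hps hpt hs ht)
  -- Sect. E's (1.114) in its CONVERSE printed use: (1.79) for the inverse pair ⇒ `Q′λ_s = 0` on `𝔅_k` ⇒ the vector `Q′λ_s` vanishes (`hq`, `hq0`)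
  have hIne : (-I : ℂ) ≠ 0 := neg_ne_zero.2 Complex.I_ne_zero
  have h114q : ∀ s : lamSubK η U₀ L k Eb, (∀ (z : Site d) (i : Fin d), lamOf s (z + P • e i) = lamOf s z) → ‖s‖ ≤ α₄ / 4 →
      Cond179 L k Λs U₀ (gaugeExp (lamOf s + (fun lam => (-I) • H' (Dp lam)) (lamOf s)))⁻¹ u₁⁻¹ → q (lamOf s) = 0 := by
    intro s hp hs hC
    have hfun : (gaugeExp (lamOf s + (-I) • H' (Dp (lamOf s))))⁻¹ = fun x => expUnit (((-I) • lamOf s - H' (Dp (lamOf s))) x) := by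
      funext x
      rw [Pi.inv_apply, gaugeExp, val_inv_expUnit]
      congr 1
      rw [Pi.add_apply, Pi.smul_apply, smul_add, smul_smul, Pi.sub_apply, Pi.smul_apply, sub_eq_add_neg,
        show (I : ℂ) * (-I) = (1 : ℂ) by rw [mul_neg, Complex.I_mul_I, neg_neg], one_smul, neg_add, ← neg_smul]
    funext j y
    by_cases hjy : j ≤ k ∧ y ∈ Λs j
    · have h1 : Qnl L U₀ (fun x => expUnit (((-I) • lamOf s - H' (Dp (lamOf s))) x)) u₁⁻¹ j y = 0 := by
        have h := hC j hjy.1 y hjy.2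
        rwa [show (fun lam => (-I) • H' (Dp lam)) (lamOf s) = (-I) • H' (Dp (lamOf s)) from rfl, hfun] at h
      rw [(hDp s hp hs).2.2.2.2.2 j hjy.1 y hjy.2] at h1
      have h2 := congrFun (QprimeIter_smul (zdBlocking d L) (bgT L U₀) (-I) (lamOf s) j) y
      rw [show ((-I) • lamOf s : Site d → 𝔸) = fun x => (-I) • lamOf s x from rfl, h2] at h1
      have h3 : QprimeIter (zdBlocking d L) (bgT L U₀) j (lamOf s) y = 0 := (smul_eq_zero.1 h1).resolve_left hIne
      rw [hq _ j hjy.1 y hjy.2, h3]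
      rfl
    · rw [hq0 _ j y hjy]
      rfl
  -- r04's Prop-10 windows at 8α₄ and the local route's product window, from the Sect. E windows and `hprod8`
  have hC6 : (0 : ℝ) ≤ C6 d := by
    have : (2 : ℝ) ≤ C6 d := by unfold C6; linarith only [one_le_C5 (d := d)]
    linarith only [this]
  have hw₁ : 10 * C6 d * (4 * (2 * α₄)) ≤ 1 := by nlinarith only [hs₁, hC6, hα₄.le]
  have hw₂ : 3000 * ((d : ℝ) + 1) * L * (4 * (2 * α₄)) ≤ 1 := by
    have e : 3000 * ((d : ℝ) + 1) * L * (4 * (2 * α₄)) = 12000 * ((d : ℝ) + 1) * L * (2 * α₄) := by ring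
    rw [e]; exact hs₂
  have hprod : 2 * C6 d * (α₃ + 4 * (2 * α₄)) < 1 / 2 := by nlinarith only [hprod8, hC6, hα₃, hα₄.le]
  -- (207) at 2α₄ for −iλ′ on the towers, from the ρ-ball (ρ < 2α₄); hence (1.79) for each competitor by §1
  have hρ2 : ρ < 2 * α₄ := by linarith
  have h179_of : ∀ lam' : Site d → 𝔸, (∀ x, ‖lam' x‖ ≤ ρ) → (∀ j, j ≤ k → ∀ p ∈ Eb j, wt L η j * ‖covDerivFwd η U₀ p.2 lam' p.1‖ ≤ ρ) →
      Restr129 L k Λs U₀ (u₁ * gaugeExp lam') → Cond179 L k Λs U₀ (gaugeExp lam')⁻¹ u₁⁻¹ := by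
    intro lam' hl' hD' h129'
    have h177b : ∀ j, j ≤ k → ∀ y ∈ Λs j, ∀ x : Site d, InBox (tlo L y j) (thi L y j) x → ‖((-I) • lam') x‖ < 2 * α₄ := by
      intro j _ y _ x _
      rw [Pi.smul_apply, norm_negI_smul]
      exact (hl' x).trans_lt hρ2
    have h177a : ∀ j, j ≤ k → ∀ y ∈ Λs j, ∀ (x : Site d) (κ : Fin d), InBox (tlo L y j) (thi L y j) x →
        InBox (tlo L y j) (thi L y j) (x + e κ) → ‖cj (U₀ x κ) (((-I) • lam') (x + e κ)) - ((-I) • lam') x‖ < 2 * α₄ * ((L : ℝ) ^ j)⁻¹ := by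
      intro j hj y hy x κ hx hxe
      have hLj : (0 : ℝ) < ((L : ℝ) ^ j)⁻¹ := by
        have : (0 : ℝ) < L := by exact_mod_cast hL1
        positivity
      have hb : (x, κ) ∈ Eb j := hEbT j hj y hy x κ hx hxe
      rw [Pi.smul_apply, Pi.smul_apply, cj_smul_complex, ← smul_sub, norm_negI_smul]
      calc ‖cj (U₀ x κ) (lam' (x + e κ)) - lam' x‖ ≤ ρ * ((L : ℝ) ^ j)⁻¹ := cjDiff_le_of_weighted hL1 hη (hD' j hj (x, κ) hb)
        _ < 2 * α₄ * ((L : ℝ) ^ j)⁻¹ := mul_lt_mul_of_pos_right hρ2 hLj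
    exact cond179_gaugeExp_of_restr129_local hL hL1 hU₀ hα hα3 hα2 hα₃ (by linarith) (by positivity) h33 hwit h177b h177a hw₁ hw₂ hs₃ hs₄
      hs₅ hs₆ hprod h129 h129'
  have h179₁ := h179_of lam₁ hl₁ hD₁ h129₁
  have h179₂ := h179_of lam₂ hl₂ hD₂ h129₂
  -- the SOURCED engine
  exact hFP_unique_of_cond146_bdd_per hL1 hη hU₀ P hΩ0 hEbΩ g Δ q qs Aw c g_leftB c_left' hΔ hqs hU₀per hAper hAw_per
    (fun lam => (-I) • H' (Dp lam)) hα₄.le hBG hBR hhE hhE₂ hlE0 hlE0 hlE₂ hcA hcA' hcDA ha₁' hb₁' hb₁ hθ hlE hlE hρ hρ hG hGper hRbd hc0 hc1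
    hc2 hcL0 hcL1 hcper hcL2 hDA hmf hf hfper hA h103 h106 h114q hl₁per hl₁ hD₁ hmult₁ h179₁ hl₂per hl₂ hD₂ hmult₂ h179₂


end SectEWSrc

#print axioms hFP_unique_of_sectE_local_wb_src_per

end Literature.MathematicalPhysics.QuantumFieldTheory.Balaban1983to89.B8Prop5UniqSectEWSrcPer

end
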